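import Literature.Geometry.Lorentzian.TameChartCompactnessFramed
import Literature.Geometry.Lorentzian.SpacetimeLocalConvergenceReverse
import Literature.Geometry.Lorentzian.SpacetimeLocalConvergenceSubseq
import HarnessLib

/-!
# Framed local Cheeger–Gromov compactness without orientation hypothesis

`Spacetime.exists_nearFramedChart_subconvergesLocallyTo_of_locallyBounded` asks that `dΨₙ(A⁻¹∂₀)` be
future-directed at the centre. Framed pinching makes `dΨₙ(A⁻¹∂₀)` TIMELIKE, hence future- or
past-directed; along a subsequence one alternative holds for all `n`. In the past case the
oriented theorem applies to the time-REVERSED sources (same metrics, same framed deviations), and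
reversed sources converge to `L.spacetime` iff the sources converge to `(L.spacetime).reverse`
(`Spacetime.subconvergesLocallyTo_reverse_sources_iff`). Result: the oriented theorem's conclusion
with the limit time-oriented by `A⁻¹∂₀` OR by `−A⁻¹∂₀`
(`Spacetime.exists_nearFramedChart_subconvergesLocallyTo_of_locallyBounded_unoriented`).

## References
* P. Petersen, *Riemannian Geometry*, 2nd ed., Springer 2006, Ch. 10 §3.2. [Petersen2006]
* B. O'Neill, *Semi-Riemannian geometry*, 1983, Ch. 5, Lemma 5.26 ff., p. 145. [ONeill1983]
-/

noncomputable section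

open Set Filter TopologicalSpace Function
open scoped Manifold ContDiff Topology ENNReal

universe u

namespace Literature.Geometry.Lorentzian

namespace Spacetime

variable {𝓢ₙ : ℕ → Spacetime.{u} 4} {pₙ : ∀ n, (𝓢ₙ n).carrier} {O : Opens E4} {𝔉 : FrameField O}

/-- Framed pinching at the centre makes `dΨ(A⁻¹∂₀)` causal there. [cite: ONeill1983, Ch. 5, Lemma 5.26] -/
theorem isCausal_mfderiv_Ainv_basisVector_zero_of_norm_framedDeviation_lt_one (𝓢 : Spacetime.{u} 4)
    (Ψ : O → 𝓢.carrier) (hΨ : ContMDiff 𝓘(ℝ, E4) (𝓡 4) ∞ Ψ) {y₀ : E4} (hy₀ : y₀ ∈ (O : Set E4))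
    (h : ‖𝓢.framedDeviation 𝔉 Ψ ⟨y₀, hy₀⟩ y₀‖ < 1) :
    𝓢.metric.IsCausal (mfderiv 𝓘(ℝ, E4) (𝓡 4) Ψ ⟨y₀, hy₀⟩ (𝔉.Ainv y₀ (E4.basisVector 0))) := by
  have hd : MDifferentiableAt 𝓘(ℝ, E4) (𝓡 4) Ψ ⟨y₀, hy₀⟩ := (hΨ _).mdifferentiableAt (by simp)
  have h' : ‖framedBilin (𝓢.metricInCoords (Ψ ∘ (chartAt E4 (⟨y₀, hy₀⟩ : O)).symm)) 𝔉.Ainv y₀ -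
      Minkowski.bilin‖ < 1 := h
  have h1 := Minkowski.apply_basisVector_zero_neg_of_norm_sub_bilin_lt_one h'
  rw [framedBilin_apply] at h1
  have e := 𝓢.metricInCoords_comp_chartAt_symm_apply (Minkowski.backgroundOn O) Ψ ⟨y₀, hy₀⟩ hy₀ hd
    (𝔉.Ainv y₀ (E4.basisVector 0)) (𝔉.Ainv y₀ (E4.basisVector 0))
  have h2 : 𝓢.metric.val (Ψ ⟨y₀, hy₀⟩)
      (mfderiv 𝓘(ℝ, E4) (𝓡 4) Ψ ⟨y₀, hy₀⟩ (𝔉.Ainv y₀ (E4.basisVector 0)))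
      (mfderiv 𝓘(ℝ, E4) (𝓡 4) Ψ ⟨y₀, hy₀⟩ (𝔉.Ainv y₀ (E4.basisVector 0))) < 0 :=
    lt_of_eq_of_lt e.symm h1
  exact LorentzianMetric.IsTimelike.isCausal (g := 𝓢.metric) h2

/-- **Framed local Cheeger–Gromov compactness, no orientation hypothesis** (module docstring).
[cite: Petersen2006, Ch. 10 §3.2] -/
theorem exists_nearFramedChart_subconvergesLocallyTo_of_locallyBounded_unoriented
    (hO : IsConnected (O : Set E4)) {y₀ : E4}
    (hy₀ : y₀ ∈ (O : Set E4)) (Ψ : ∀ n, O → (𝓢ₙ n).carrier)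
    (hΨ : ∀ n, ContMDiff 𝓘(ℝ, E4) (𝓡 4) ∞ (Ψ n)) (hinj : ∀ n, Injective (Ψ n))
    (hcentre : ∀ n, Ψ n ⟨y₀, hy₀⟩ = pₙ n) {θ : ℝ} (hθ : θ < 1)
    (hpinch : ∀ n, ∀ y ∈ (O : Set E4), ‖(𝓢ₙ n).framedDeviation 𝔉 (Ψ n) ⟨y₀, hy₀⟩ y‖ ≤ θ)
    (hb : ∀ (i : ℕ), ∀ K ⊆ (O : Set E4), IsCompact K → ∃ Λ : ℝ, ∀ n, ∀ z ∈ K,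
      ‖iteratedFDeriv ℝ i ((𝓢ₙ n).framedDeviation 𝔉 (Ψ n) ⟨y₀, hy₀⟩) z‖ ≤ Λ) :
    ∃ (L : NearFramedChart O 𝔉) (φ : ℕ → ℕ), StrictMono φ ∧
      (∀ y ∈ (O : Set E4), ‖L.framed.G y - Minkowski.bilin‖ ≤ θ) ∧
      (∀ (k : ℕ), ∀ K ⊆ (O : Set E4), IsCompact K →
        Tendsto (fun j ↦ supCkENorm K k
          ((𝓢ₙ (φ j)).framedDeviation 𝔉 (Ψ (φ j)) ⟨y₀, hy₀⟩ - (L.framed.G - fun _ ↦ Minkowski.bilin)))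
          atTop (𝓝 0)) ∧
      (∀ (k : ℕ), ∀ K ⊆ (O : Set E4), IsCompact K →
        Tendsto (fun j ↦ supCkENorm K k
          ((𝓢ₙ (φ j)).metricInCoords (Ψ (φ j) ∘ (chartAt E4 (⟨y₀, hy₀⟩ : O)).symm) - L.G))
          atTop (𝓝 0)) ∧
      ((∀ k : ℕ, SubconvergesLocallyTo 𝓢ₙ pₙ (L.spacetime hO) ⟨y₀, hy₀⟩ k) ∨
        (∀ k : ℕ, SubconvergesLocallyTo 𝓢ₙ pₙ (L.spacetime hO).reverse ⟨y₀, hy₀⟩ k)) := by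
  have hcausal : ∀ n, (𝓢ₙ n).metric.IsCausal
      (mfderiv 𝓘(ℝ, E4) (𝓡 4) (Ψ n) ⟨y₀, hy₀⟩ (𝔉.Ainv y₀ (E4.basisVector 0))) := fun n ↦
    (𝓢ₙ n).isCausal_mfderiv_Ainv_basisVector_zero_of_norm_framedDeviation_lt_one (Ψ n) (hΨ n) hy₀
      ((hpinch n y₀ hy₀).trans_lt hθ)
  by_cases hfreq : ∃ᶠ n in atTop, (𝓢ₙ n).timeOrientation.IsFutureDirected
      (mfderiv 𝓘(ℝ, E4) (𝓡 4) (Ψ n) ⟨y₀, hy₀⟩ (𝔉.Ainv y₀ (E4.basisVector 0)))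
  · obtain ⟨ρ, hρ, hρP⟩ := extraction_of_frequently_atTop hfreq
    obtain ⟨L, φ, hφ, h1, h2, h3, h4⟩ :=
      exists_nearFramedChart_subconvergesLocallyTo_of_locallyBounded
        (𝓢ₙ := fun n ↦ 𝓢ₙ (ρ n)) (pₙ := fun n ↦ pₙ (ρ n)) hO hy₀ (fun n ↦ Ψ (ρ n))
        (fun n ↦ hΨ (ρ n)) (fun n ↦ hinj (ρ n)) (fun n ↦ hcentre (ρ n)) hρP hθ
        (fun n ↦ hpinch (ρ n)) fun i K hKO hK ↦ (hb i K hKO hK).imp fun Λ hΛ n ↦ hΛ (ρ n)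
    exact ⟨L, ρ ∘ φ, hρ.comp hφ, h1, h2, h3, Or.inl fun k ↦ (h4 k).ofSubseq hρ⟩
  · have hev : ∀ᶠ n in atTop, (𝓢ₙ n).reverse.timeOrientation.IsFutureDirected
        (mfderiv 𝓘(ℝ, E4) (𝓡 4) (Ψ n) ⟨y₀, hy₀⟩ (𝔉.Ainv y₀ (E4.basisVector 0))) := by
      rw [not_frequently] at hfreq
      filter_upwards [hfreq] with n hn
      rcases (𝓢ₙ n).timeOrientation.isFutureDirected_or_isPastDirected_of_isCausal (hcausal n) with
        h | h
      · exact absurd h hn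
      · exact ((𝓢ₙ n).timeOrientation.isFutureDirected_reverse_iff _).2 h
    obtain ⟨ρ, hρ, hρP⟩ := extraction_of_frequently_atTop hev.frequently
    -- the oriented theorem for the REVERSED sources along `ρ` (same metrics and framed deviations)
    obtain ⟨L, φ, hφ, h1, h2, h3, h4⟩ :=
      exists_nearFramedChart_subconvergesLocallyTo_of_locallyBounded
        (𝓢ₙ := fun n ↦ (𝓢ₙ (ρ n)).reverse) (pₙ := fun n ↦ pₙ (ρ n)) hO hy₀ (fun n ↦ Ψ (ρ n))
        (fun n ↦ hΨ (ρ n)) (fun n ↦ hinj (ρ n)) (fun n ↦ hcentre (ρ n)) hρP hθ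
        (fun n ↦ hpinch (ρ n)) fun i K hKO hK ↦ (hb i K hKO hK).imp fun Λ hΛ n ↦ hΛ (ρ n)
    refine ⟨L, ρ ∘ φ, hρ.comp hφ, h1, h2, h3, Or.inr fun k ↦ ?_⟩
    exact (subconvergesLocallyTo_reverse_sources_iff.1 (h4 k)).ofSubseq hρ

end Spacetime

end Literature.Geometry.Lorentzian

end
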